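import Summits.QuantumFields.YangMills.Theorems.ColdStartUniversalityLatticeLangevinDossSussmannRetraction
import HarnessLib

/-!
# Route `ColdStartUniversality` (fixed-cut-off SZZ dynamics; Doss–Sussmann smoothing programme, file 4):
# PREPARATIONS FOR DIFFERENTIATING UNDER THE EXPECTATION

Helper file (seat `ym-line-csu-p1`, g24).  Three pieces of plumbing for the smoothing theorem `P_t(C¹) ⊂ C¹`:
* `aestronglyMeasurable_clm_of_apply` — a family of continuous linear functionals `ω ↦ L_ω` on a FINITE-DIMENSIONAL real
  space is a.e.-strongly measurable as soon as every evaluation `ω ↦ L_ω v` is (expansion in a dual basis); this is how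
  the `ω`-measurability of the derivative `D_M F(M, ω)` is obtained from difference quotients;
* `exists_leftMul_clm` — linkwise left multiplication `V ↦ (p_e V_e)_e` by a fixed frame `p` as a continuous linear map
  of the ambient configuration space with `‖·‖ ≤ 2‖p‖` (sup norms, `2 × 2` blocks);
* `aestronglyMeasurable_of_tendsto_directional` — the directional derivative of an `ω`-dependent `C¹` function is
  a.e.-strongly measurable in `ω` when the function is, at every point (limit of difference quotients, `HasFDerivAt.lim`).
THEOREMS ONLY, no sorry.  HONEST FRAMING: fixed-cut-off plumbing; nothing K-uniform; no crux, rung or summit statement is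
proved; the Yang–Mills mass gap is NOT proved.
-/

set_option autoImplicit false

noncomputable section

namespace Summit.QuantumFields.YangMills.Theorems.ColdStartUniversality

open MeasureTheory Finset Filter Set Metric Function
open scoped NNReal Matrix Topology
open Literature.MathematicalPhysics.QuantumFieldTheory

variable {L : ℕ}

/-! ## Measurability of functional-valued maps from their evaluations -/

/-- **Dual-basis expansion.**  On a finite-dimensional real normed space with basis `b`, every continuous linear functional
is `L = Σ_i L(b_i) • b^*_i` (`b^*_i` the coordinate functionals). [folklore] -/
theorem clm_eq_sum_coord {H : Type*} [NormedAddCommGroup H] [NormedSpace ℝ H] [FiniteDimensional ℝ H]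
    {ι : Type*} [Fintype ι] (b : Module.Basis ι ℝ H) (L : H →L[ℝ] ℝ) :
    L = ∑ i, (L (b i)) • LinearMap.toContinuousLinearMap (b.coord i) := by
  classical
  apply ContinuousLinearMap.coe_injective
  refine b.ext fun j => ?_
  simp only [ContinuousLinearMap.coe_coe, _root_.sum_apply]
  have hterm : ∀ i, ((L (b i)) • LinearMap.toContinuousLinearMap (b.coord i)) (b j) =
      L (b i) * (if j = i then 1 else 0) := by
    intro i
    change L (b i) • (b.coord i) (b j) = _
    rw [Module.Basis.coord_apply, Module.Basis.repr_self, Finsupp.single_apply, smul_eq_mul]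
  simp_rw [hterm]
  rw [Finset.sum_eq_single j]
  · simp
  · intro i _ hij
    rw [if_neg (Ne.symm hij), mul_zero]
  · intro h; exact absurd (Finset.mem_univ j) h

/-- ★ **A functional-valued map is a.e.-strongly measurable if all its evaluations are** (finite-dimensional domain).
[folklore] -/
theorem aestronglyMeasurable_clm_of_apply {Ω : Type*} [MeasurableSpace Ω] {μ : Measure Ω}
    {H : Type*} [NormedAddCommGroup H] [NormedSpace ℝ H] [FiniteDimensional ℝ H]
    (φ : Ω → H →L[ℝ] ℝ) (h : ∀ v : H, AEStronglyMeasurable (fun ω => φ ω v) μ) :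
    AEStronglyMeasurable φ μ := by
  let b := Module.finBasis ℝ H
  have heq : φ = fun ω => ∑ i, (φ ω (b i)) • LinearMap.toContinuousLinearMap (b.coord i) := by
    funext ω; exact clm_eq_sum_coord b (φ ω)
  have hterm : ∀ i : Fin (Module.finrank ℝ H), AEStronglyMeasurable
      (fun ω => (φ ω (b i)) • LinearMap.toContinuousLinearMap (b.coord i)) μ := fun i =>
    (h (b i)).smul (aestronglyMeasurable_const (b := LinearMap.toContinuousLinearMap (b.coord i)))
  have hsum : AEStronglyMeasurable (fun ω => ∑ i : Fin (Module.finrank ℝ H),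
      (φ ω (b i)) • LinearMap.toContinuousLinearMap (b.coord i)) μ :=
    Finset.aestronglyMeasurable_fun_sum (Finset.univ : Finset (Fin (Module.finrank ℝ H))) fun i _ => hterm i
  rw [heq]; exact hsum

/-- ★ **Measurability of directional derivatives in a parameter.**  If `F(·, ω)` has derivative `F'(ω)` at `M₀` for every
`ω` and `ω ↦ F(M, ω)` is a.e.-strongly measurable for every `M`, then so is `ω ↦ F'(ω) v` (limit of the measurable
difference quotients `n (F(M₀ + v/n, ω) − F(M₀, ω))`), and hence `ω ↦ F'(ω)` when the domain is finite-dimensional.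
[folklore] -/
theorem aestronglyMeasurable_fderiv_param {Ω : Type*} [MeasurableSpace Ω] {μ : Measure Ω}
    {H : Type*} [NormedAddCommGroup H] [NormedSpace ℝ H] [FiniteDimensional ℝ H]
    {F : H → Ω → ℝ} {F' : Ω → H →L[ℝ] ℝ} {M₀ : H}
    (hF : ∀ M, AEStronglyMeasurable (F M) μ) (hd : ∀ ω, HasFDerivAt (fun M => F M ω) (F' ω) M₀) :
    AEStronglyMeasurable F' μ := by
  refine aestronglyMeasurable_clm_of_apply F' fun v => ?_
  -- difference quotients along `n ↦ M₀ + n⁻¹ v`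
  have hlim : ∀ ω, Tendsto (fun n : ℕ => ((n : ℝ) + 1) • (F (M₀ + ((n : ℝ) + 1)⁻¹ • v) ω - F M₀ ω)) atTop
      (𝓝 (F' ω v)) := by
    intro ω
    have hc : Tendsto (fun n : ℕ => ‖(n : ℝ) + 1‖) atTop atTop := by
      have h1 : Tendsto (fun n : ℕ => (n : ℝ) + 1) atTop atTop :=
        tendsto_natCast_atTop_atTop.atTop_add tendsto_const_nhds
      refine h1.congr' (Eventually.of_forall fun n => ?_)
      show ((n : ℝ) + 1) = ‖(n : ℝ) + 1‖
      rw [Real.norm_eq_abs, abs_of_nonneg (by positivity)]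
    exact (hd ω).lim v hc
  refine aestronglyMeasurable_of_tendsto_ae atTop (fun n => ?_) (ae_of_all _ hlim)
  show AEStronglyMeasurable (((n : ℝ) + 1) • (F (M₀ + ((n : ℝ) + 1)⁻¹ • v) - F M₀)) μ
  exact ((hF (M₀ + ((n : ℝ) + 1)⁻¹ • v)).sub (hF M₀)).const_smul ((n : ℝ) + 1)

/-! ## Linkwise left multiplication by a frame as a continuous linear map -/

/-- ★ **Linkwise left multiplication `V ↦ (p_e · V_e)_e` is a continuous linear map of norm `≤ 2‖p‖`** on the ambient
configuration space `Edge → (Fin 2 → Fin 2 → ℂ)` with the sup norm (each entry is a sum of two products). [folklore] -/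
theorem exists_leftMul_clm [NeZero L] (p : Edge 3 L → Fin 2 → Fin 2 → ℂ) :
    ∃ Lp : (Edge 3 L → Fin 2 → Fin 2 → ℂ) →L[ℝ] (Edge 3 L → Fin 2 → Fin 2 → ℂ),
      (∀ V, Lp V = fun (e : Edge 3 L) (k l : Fin 2) => (Matrix.of (p e) * Matrix.of (V e)) k l) ∧
      ‖Lp‖ ≤ 2 * ‖p‖ := by
  let T : (Edge 3 L → Fin 2 → Fin 2 → ℂ) →ₗ[ℝ] (Edge 3 L → Fin 2 → Fin 2 → ℂ) :=
    { toFun := fun V e k l => (Matrix.of (p e) * Matrix.of (V e)) k l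
      map_add' := fun V V' => by
        funext e k l
        simp only [Pi.add_apply]
        rw [← Matrix.add_apply, ← Matrix.mul_add]; rfl
      map_smul' := fun c V => by
        funext e k l
        simp only [Pi.smul_apply, RingHom.id_apply]
        rw [← Matrix.smul_apply, ← Matrix.mul_smul]; rfl }
  have hbound : ∀ V, ‖T V‖ ≤ 2 * ‖p‖ * ‖V‖ := by
    intro V
    have h0 : 0 ≤ 2 * ‖p‖ * ‖V‖ := by positivity
    refine (pi_norm_le_iff_of_nonneg h0).2 fun e => (pi_norm_le_iff_of_nonneg h0).2 fun k =>
      (pi_norm_le_iff_of_nonneg h0).2 fun l => ?_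
    show ‖(Matrix.of (p e) * Matrix.of (V e)) k l‖ ≤ 2 * ‖p‖ * ‖V‖
    rw [Matrix.mul_apply, Fin.sum_univ_two]
    have hp : ∀ m, ‖Matrix.of (p e) k m‖ ≤ ‖p‖ := fun m =>
      (norm_le_pi_norm (p e k) m).trans ((norm_le_pi_norm (p e) k).trans (norm_le_pi_norm p e))
    have hV : ∀ m, ‖Matrix.of (V e) m l‖ ≤ ‖V‖ := fun m =>
      (norm_le_pi_norm (V e m) l).trans ((norm_le_pi_norm (V e) m).trans (norm_le_pi_norm V e))
    calc ‖Matrix.of (p e) k 0 * Matrix.of (V e) 0 l + Matrix.of (p e) k 1 * Matrix.of (V e) 1 l‖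
        ≤ ‖Matrix.of (p e) k 0‖ * ‖Matrix.of (V e) 0 l‖ + ‖Matrix.of (p e) k 1‖ * ‖Matrix.of (V e) 1 l‖ :=
          (norm_add_le _ _).trans (add_le_add (norm_mul_le _ _) (norm_mul_le _ _))
      _ ≤ ‖p‖ * ‖V‖ + ‖p‖ * ‖V‖ :=
          add_le_add (mul_le_mul (hp 0) (hV 0) (norm_nonneg _) (norm_nonneg _))
            (mul_le_mul (hp 1) (hV 1) (norm_nonneg _) (norm_nonneg _))
      _ = 2 * ‖p‖ * ‖V‖ := by ring
  refine ⟨T.mkContinuous (2 * ‖p‖) hbound, fun V => rfl, ?_⟩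
  exact LinearMap.mkContinuous_norm_le _ (by positivity) _

end Summit.QuantumFields.YangMills.Theorems.ColdStartUniversality

end
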